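import Summits.BirchSwinnertonDyer.Rank1Residual.Supersingular.MazurTateHeckeDescentLayerZero
import Summits.BirchSwinnertonDyer.Rank1Residual.Supersingular.MazurTateLayerConsistency
import Summits.BirchSwinnertonDyer.Rank1Residual.Supersingular.SharpFlatRankZeroReal
import HarnessLib

/-!
# Hecke descent of the Mazur–Tate elements, part 3 — class X8 (`p = 3`, `a_3 = ±3`): FORCED
# cyclotomic zeros of `θ_n` at the layers `n − 5, n − 11, …` and the CROSS-LAYER constraints
# `r + Σ_{k∈S} φ(3^{k+1}) ≤ deg ω_n^± + λ(L^•)`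
# (cell `b2b-bsdres`, supersingular family, prover B = unit `b2b-bsdres-additive-p3`, gen 9; part 3)

HONEST FRAMING (run/shared/lean/b2b/bsd-rank1-residual/, verbatim in every file): the goal of the
cell is to DELETE the COMBINATION-SHAPED residual classes of the Birch–Swinnerton-Dyer formula for
ALL analytic-rank `≤ 1` elliptic curves over `ℚ` — "full BSD formula for every rank `≤ 1` curve in
class `C`" assembled STRICTLY from published theorems — so that the rank-`≤ 1` remainder becomes
exactly the CONSTRUCTION-SHAPED classes, which are TYPED (missing-input `Prop`s), NOT attempted.
This is not "finishing BSD". THEOREMS ONLY (no definition, no named fact, no `sorry`); nothing about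
any particular curve is asserted; nothing is booked; X8 / X7 / X6 stay CONSTRUCTION-SHAPED.

## What this file proves (parts 1a/1b/2: `MazurTateHeckeDescentSeq.lean`, `MazurTateHeckeDescent.lean`,
`MazurTateHeckeDescentLayerZero.lean`)

On `ClassX8 W p` (`p = 3`, good supersingular, `a_3 ≠ 0`, so `a_3 = ±3` and `c_{j+6} = −27c_j`,
`c_j = 0 ↔ j ≡ 5 (mod 6)` for the Hecke descent sequence):
* `X8.eval₂_mazurTateElement_eq_zero_of_mod_six` — **`θ_n(ζ − 1) = 0` for every `ζ` of order
  `3^{k+1}` with `k + 1 ≤ n`, `n − (k+1) ≡ 5 (mod 6)`**, i.e. `Φ_{3^{k+1}}(X+1) ∣ θ_n` in `ℚ[X]`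
  (`X8.cyclotomic_comp_dvd_mazurTateElement_of_mod_six`): FORCED ("trivial") cyclotomic zeros of the
  Mazur–Tate elements of an X8 curve at the layers `n − 5, n − 11, …` (no information about `E`);
* the mixed accounting with this forced clause (`X8.add_sum_totient_le_lam_of_mazurTate_layers`;
  complex side `…_of_twistedLValue_eq_zero`: the vanishing clause is `L_χ(1) = 0`);
* for THE Sprung pair with `L♯ ≠ 0`, `μ(L♯) = 0`, `λ(L♯) + deg ω_n^+ < 3ⁿ` (`n` odd; resp. `♭`, `n`
  even) — where gen 4 reads `λ(θ_n) = deg ω_n^± + λ(L^•)` —, the **CROSS-LAYER CONSTRAINTS**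
  `X8.add_sum_totient_le_natDegree_add_lam_sharp/flat`:
  **`r + Σ_{k ∈ S} φ(3^{k+1}) ≤ deg ω_n^± + λ(L^•)`** for every finite set `S` of forced-or-vanishing
  layers `k + 1 ≤ n`, and the rank-one forms with `r = 1` from `ord_{s=1}L(E,s) ≠ 0` (part 2 §5).
  The per-layer thresholds of gen 8 §13 (e) (`λ♯ ≥ 2, 12, 102` for a vanishing conductor `9, 81, 729`
  read at `n = 1, 3, 5`; `λ♭ ≥ 4, 34` for `27, 243` at `n = 2, 4`) are the case `S = {n − 1}`; NEW are
  the joint ones, e.g. conductors `9` AND `27` both vanishing ⇒ `λ♭ ≥ 6 + r` (`n = 2`) and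
  `λ♯ ≥ 2 + r` (`n = 3`) — met with EQUALITY `λ♯ = 2` by the rank-0 X8 pair 12155f1 of the census
  (engine B: `λ(θ_1) = 2`, `θ_2 ≡ 0`, `λ(θ_3) = 8 = 2 + 6`, `λ(θ_4) = 28`, `λ(θ_5) = 62`; nothing booked).

References: [MazurTateTeitelbaum1986Invent] §I.4 (4.2), §I.8 (8.6), §I.10 (10.2); [Sprung2017]
Cor. 3.6, Cor. 4.4, Cor. 4.11, Thm. 1.12; [Pollack2003] Prop. 6.9–6.10, 6.18; [Washington1997] §7.1–7.2.
Memo: `HOME/b2b-bsdres-additive-p3/X8-ROUTE-B.md` §14 (gen 9).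
-/

set_option autoImplicit false

noncomputable section

open scoped Classical MatrixGroups ModularForm

open CongruenceSubgroup Polynomial WeierstrassCurve Literature.NumberTheory.EllipticCurves
  Literature.NumberTheory.EllipticCurves.ModularForms
  Literature.NumberTheory.EllipticCurves.Sprung2017
  Literature.NumberTheory.EllipticCurves.Rank1Residual
  Summit.BirchSwinnertonDyer.Rank1Residual.X1.MuLambda
  Summit.BirchSwinnertonDyer.Rank1Residual.Iwasawa

namespace Summit.BirchSwinnertonDyer.Rank1Residual.Supersingular

/-! ## §7. Class X8 (`p = 3`, `a_3 = ±3`): forced zeros at distance `≡ 5 (mod 6)` and the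
cross-layer constraints -/

section X8

variable {W : WeierstrassCurve ℚ} [W.IsElliptic] [W.IsGloballyMinimal] {N : ℕ} [NeZero N]
  {f : CuspForm (Gamma0 N) 2} {p : ℕ} [hp : Fact p.Prime]

/-- On X8, `a_3² = 9`. [cite: SilvermanAEC2009, Thm. V.1.1] -/
theorem ClassX8.frobeniusTrace_sq (hX : ClassX8 W p) : W.frobeniusTrace 3 ^ 2 = 9 := by
  rcases ClassX8.frobeniusTrace_eq_three_or W p hX with h | h <;> rw [h] <;> norm_num

/-- **FORCED ZEROS OF THE MAZUR–TATE ELEMENTS ON X8.** For an X8 pair (`p = 3` good supersingular,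
`a_3 = ±3`), `f` the newform of `E = W`, and layers `k + 1 ≤ n` with **`n − (k+1) ≡ 5 (mod 6)`**:
`θ_n(ζ − 1) = 0` for EVERY `ζ ∈ ℂ_3` of order exactly `3^{k+1}` — i.e. the (imprimitive) Birch sums
`∑_{a mod 3^{n+1}} χ(a)[a/3^{n+1}]⁺_f` vanish identically for all characters `χ` of `Γ` of order
`3^{k+1}`, whatever `E` is (`c_{n−k−1}(±3, 3) = 0`: `c_5 = c_11 = ⋯ = 0`). [cite: MazurTateTeitelbaum1986Invent, §I.10 Prop. (10.2)] -/
theorem X8.eval₂_mazurTateElement_eq_zero_of_mod_six (hX : ClassX8 W p) (hf : IsNewformOf W f)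
    {k n : ℕ} (hkn : k + 1 ≤ n) (hmod : (n - (k + 1)) % 6 = 5) {ζ : ℂ_[p]}
    (hζ : IsPrimitiveRoot ζ (p ^ (k + 1))) :
    (mazurTateElement f p n).eval₂ (algebraMap ℚ ℂ_[p]) (ζ - 1) = 0 := by
  have hsq := ClassX8.frobeniusTrace_sq hX
  obtain ⟨rfl, ⟨hgood, -⟩, -⟩ := hX
  obtain ⟨c, hc0, hc1, hrec⟩ := exists_heckeDescentSeq (W.frobeniusTrace 3) 3
  rw [eval₂_mazurTateElement_eq_mul_of_le hf.1 hf.coeffField_eq_bot (not_dvd_level_of_isNewformOf hf hgood)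
    (cuspCoeff_eq_frobeniusTrace_of_isNewformOf_holds hf hgood) hkn hζ hc0 hc1 hrec,
    (heckeDescentSeq_eq_zero_iff_of_three hsq hc0 hc1 hrec _).mpr hmod, Int.cast_zero, zero_mul]

/-- **Divisibility form**: on X8, `Φ_{3^{k+1}}(X + 1) ∣ θ_n` in `ℚ[X]` whenever `k + 1 ≤ n` and
`n − (k+1) ≡ 5 (mod 6)` (minimal polynomial of `ζ − 1`). So `λ` of any integral model of `θ_n` is at
least `φ(3^{k+1})` for each such layer — zeros of `θ_n` that carry no information about `E`.
[cite: MazurTateTeitelbaum1986Invent, §I.10 Prop. (10.2)] -/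
theorem X8.cyclotomic_comp_dvd_mazurTateElement_of_mod_six (hX : ClassX8 W p) (hf : IsNewformOf W f)
    {k n : ℕ} (hkn : k + 1 ≤ n) (hmod : (n - (k + 1)) % 6 = 5) :
    (cyclotomic (p ^ (k + 1)) ℚ).comp (X + 1) ∣ mazurTateElement f p n := by
  obtain ⟨ζ, hζ⟩ := exists_isPrimitiveRoot_padicComplex (p := p) k
  exact cyclotomic_comp_X_add_one_dvd_of_eval₂_eq_zero hζ (pow_pos hp.out.pos _)
    (X8.eval₂_mazurTateElement_eq_zero_of_mod_six hX hf hkn hmod hζ)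

/-- **Mixed-layer accounting on X8** (`λ(Θ)` form): `Θ ≠ 0` an integral model of `θ_n` of an X8 pair,
`T^r ∣ Θ`, `S` a finite set of layers `k + 1 ≤ n`, each with `n − (k+1) ≡ 5 (mod 6)` (forced) or
carrying a primitive even `3`-power-order `χ` of conductor `3^{k+2}` with vanishing Birch sum ⇒
`r + Σ_{k ∈ S} φ(3^{k+1}) ≤ λ(Θ)`. [cite: MazurTateTeitelbaum1986Invent, §I.10 Prop. (10.2) and §I.13]
[cite: Washington1997, §7.1–7.2 and Thm. 7.3] -/
theorem X8.add_sum_totient_le_lam_of_mazurTate_layers (hX : ClassX8 W p) (hf : IsNewformOf W f)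
    {n : ℕ} {Θ : IwasawaAlgebra p}
    (hΘ : iwasawaToPowerSeries p Θ =
      ((mazurTateElement f p n).map (algebraMap ℚ ℚ_[p]) : PowerSeries ℚ_[p]))
    (hΘ0 : Θ ≠ 0) {r : ℕ} (hXr : (PowerSeries.X : IwasawaAlgebra p) ^ r ∣ Θ) (S : Finset ℕ)
    (hS : ∀ k ∈ S, k + 1 ≤ n ∧ ((n - (k + 1)) % 6 = 5 ∨
      ∃ χ : DirichletCharacter ℂ_[p] (p ^ (k + 1 + cyclotomicExponent p)), χ.IsPrimitive ∧ χ.Even ∧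
        (∃ j : ℕ, orderOf χ = p ^ j) ∧ ratTwistedSymbolSum f χ = 0)) :
    r + ∑ k ∈ S, Nat.totient (p ^ (k + 1)) ≤ lam Θ := by
  have hsq := ClassX8.frobeniusTrace_sq hX
  obtain ⟨rfl, ⟨hgood, -⟩, -⟩ := hX
  obtain ⟨c, hc0, hc1, hrec⟩ := exists_heckeDescentSeq (W.frobeniusTrace 3) 3
  refine Supersingular.add_sum_totient_le_lam_of_mazurTate_layers hf.1 hf.coeffField_eq_bot
    (not_dvd_level_of_isNewformOf hf hgood) (cuspCoeff_eq_frobeniusTrace_of_isNewformOf_holds hf hgood)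
    hΘ hΘ0 hXr hc0 hc1 hrec S fun k hk ↦ ?_
  obtain ⟨hkn, hmod | hvan⟩ := hS k hk
  · exact ⟨hkn, Or.inl ((heckeDescentSeq_eq_zero_iff_of_three hsq hc0 hc1 hrec _).mpr hmod)⟩
  · exact ⟨hkn, Or.inr hvan⟩

/-- **Mixed-layer accounting on X8, complex side**: the vanishing clause is `L_χ(1) = 0` for a
primitive even `3`-power-order Dirichlet character `χ` of conductor `3^{k+2}` and any entire
continuation `L_χ` of `L(E, χ, s)`. [cite: MazurTateTeitelbaum1986Invent, §I.8 (8.6), §I.10 Prop. (10.2)]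
[cite: Washington1997, §7.1–7.2 and Thm. 7.3] -/
theorem X8.add_sum_totient_le_lam_of_mazurTate_layers_of_twistedLValue_eq_zero (hX : ClassX8 W p)
    (hf : IsNewformOf W f) {n : ℕ} {Θ : IwasawaAlgebra p}
    (hΘ : iwasawaToPowerSeries p Θ =
      ((mazurTateElement f p n).map (algebraMap ℚ ℚ_[p]) : PowerSeries ℚ_[p]))
    (hΘ0 : Θ ≠ 0) {r : ℕ} (hXr : (PowerSeries.X : IwasawaAlgebra p) ^ r ∣ Θ) (S : Finset ℕ)
    (hS : ∀ k ∈ S, k + 1 ≤ n ∧ ((n - (k + 1)) % 6 = 5 ∨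
      ∃ χ : DirichletCharacter ℂ (p ^ (k + 1 + cyclotomicExponent p)), χ.IsPrimitive ∧ χ.Even ∧
        (∃ j : ℕ, orderOf χ = p ^ j) ∧ ∃ Lχ : ℂ → ℂ, Differentiable ℂ Lχ ∧
          (∀ s : ℂ, 2 < s.re → Lχ s = twistedLSeries f χ s) ∧ Lχ 1 = 0)) :
    r + ∑ k ∈ S, Nat.totient (p ^ (k + 1)) ≤ lam Θ := by
  have hsq := ClassX8.frobeniusTrace_sq hX
  obtain ⟨rfl, ⟨hgood, -⟩, -⟩ := hX
  obtain ⟨c, hc0, hc1, hrec⟩ := exists_heckeDescentSeq (W.frobeniusTrace 3) 3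
  refine add_sum_totient_le_lam_of_mazurTate_layers_of_twistedLValue_eq_zero hf hgood hΘ hΘ0 hXr hc0
    hc1 hrec S fun k hk ↦ ?_
  obtain ⟨hkn, hmod | hvan⟩ := hS k hk
  · exact ⟨hkn, Or.inl ((heckeDescentSeq_eq_zero_iff_of_three hsq hc0 hc1 hrec _).mpr hmod)⟩
  · exact ⟨hkn, Or.inr hvan⟩

/-- **CROSS-LAYER CONSTRAINT ON X8, colour `♯` (odd `n`).** `f` the newform of an X8 curve `E = W`,
`(L♯, L♭)` ANY Sprung pair (= THE pair, p214240) with `L♯ ≠ 0`, `μ(L♯) = 0` and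
`λ(L♯) + deg ω_n^+ < 3ⁿ` for an ODD `n` (then `λ(θ_n) = deg ω_n^+ + λ(L♯)`, gen 4); `Θ` an integral
model of `θ_n` with `T^r ∣ Θ`; `S` a finite set of layers `k + 1 ≤ n`, each forced
(`n − (k+1) ≡ 5 (mod 6)`) or vanishing (Birch sum of a primitive even `3`-power-order `χ` of conductor
`3^{k+2}` is `0`). Then **`r + Σ_{k ∈ S} φ(3^{k+1}) ≤ deg ω_n^+ + λ(L♯)`**.
[cite: Sprung2017, §3, Cor. 3.6 and Thm. 1.12] [cite: Pollack2003, Prop. 6.9 and Prop. 6.10]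
[cite: Washington1997, §7.1–7.2 and Thm. 7.3] -/
theorem X8.add_sum_totient_le_natDegree_add_lam_sharp (hX : ClassX8 W p) (hf : IsNewformOf W f)
    {Lsharp Lflat : IwasawaAlgebra p} (hSP : IsSprungPair f p (W.frobeniusTrace p) Lsharp Lflat)
    {n : ℕ} (hn : Odd n) (hL0 : Lsharp ≠ 0) (hμ : mu Lsharp = 0)
    (hlt : lam Lsharp + (cyclotomicOmegaPlus p n).natDegree < p ^ n) {Θ : IwasawaAlgebra p}
    (hΘ : iwasawaToPowerSeries p Θ =
      ((mazurTateElement f p n).map (algebraMap ℚ ℚ_[p]) : PowerSeries ℚ_[p]))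
    {r : ℕ} (hXr : (PowerSeries.X : IwasawaAlgebra p) ^ r ∣ Θ) (S : Finset ℕ)
    (hS : ∀ k ∈ S, k + 1 ≤ n ∧ ((n - (k + 1)) % 6 = 5 ∨
      ∃ χ : DirichletCharacter ℂ_[p] (p ^ (k + 1 + cyclotomicExponent p)), χ.IsPrimitive ∧ χ.Even ∧
        (∃ j : ℕ, orderOf χ = p ^ j) ∧ ratTwistedSymbolSum f χ = 0)) :
    r + ∑ k ∈ S, Nat.totient (p ^ (k + 1)) ≤ (cyclotomicOmegaPlus p n).natDegree + lam Lsharp := by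
  have hX' := hX
  obtain ⟨rfl, ⟨hgood, hap⟩, -⟩ := hX
  have hp2 : (3 : ℕ) ≠ 2 := by decide
  obtain ⟨Q, hQ⟩ := exists_integral_mazurTate_of_isSprungPair hp2 hf hgood hap hSP n
  have hΘeq := iwasawaToPowerSeries_injective 3 (hΘ.trans hQ)
  obtain ⟨hΘ0, -, hlam⟩ := lam_eq_lam_add_of_mu_eq_zero_of_odd hap hn hΘeq hL0 hμ hlt
  have h := X8.add_sum_totient_le_lam_of_mazurTate_layers hX' hf hΘ hΘ0 hXr S hS
  omega

/-- **CROSS-LAYER CONSTRAINT ON X8, colour `♭` (even `n`)**: the same with `L♭ ≠ 0`, `μ(L♭) = 0`,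
`λ(L♭) + deg ω_n^- < 3ⁿ`, conclusion **`r + Σ_{k ∈ S} φ(3^{k+1}) ≤ deg ω_n^- + λ(L♭)`**.
[cite: Sprung2017, §3, Cor. 3.6 and Thm. 1.12] [cite: Pollack2003, Prop. 6.9 and Prop. 6.10]
[cite: Washington1997, §7.1–7.2 and Thm. 7.3] -/
theorem X8.add_sum_totient_le_natDegree_add_lam_flat (hX : ClassX8 W p) (hf : IsNewformOf W f)
    {Lsharp Lflat : IwasawaAlgebra p} (hSP : IsSprungPair f p (W.frobeniusTrace p) Lsharp Lflat)
    {n : ℕ} (hn : Even n) (hL0 : Lflat ≠ 0) (hμ : mu Lflat = 0)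
    (hlt : lam Lflat + (cyclotomicOmegaMinus p n).natDegree < p ^ n) {Θ : IwasawaAlgebra p}
    (hΘ : iwasawaToPowerSeries p Θ =
      ((mazurTateElement f p n).map (algebraMap ℚ ℚ_[p]) : PowerSeries ℚ_[p]))
    {r : ℕ} (hXr : (PowerSeries.X : IwasawaAlgebra p) ^ r ∣ Θ) (S : Finset ℕ)
    (hS : ∀ k ∈ S, k + 1 ≤ n ∧ ((n - (k + 1)) % 6 = 5 ∨
      ∃ χ : DirichletCharacter ℂ_[p] (p ^ (k + 1 + cyclotomicExponent p)), χ.IsPrimitive ∧ χ.Even ∧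
        (∃ j : ℕ, orderOf χ = p ^ j) ∧ ratTwistedSymbolSum f χ = 0)) :
    r + ∑ k ∈ S, Nat.totient (p ^ (k + 1)) ≤ (cyclotomicOmegaMinus p n).natDegree + lam Lflat := by
  have hX' := hX
  obtain ⟨rfl, ⟨hgood, hap⟩, -⟩ := hX
  have hp2 : (3 : ℕ) ≠ 2 := by decide
  obtain ⟨Q, hQ⟩ := exists_integral_mazurTate_of_isSprungPair hp2 hf hgood hap hSP n
  have hΘeq := iwasawaToPowerSeries_injective 3 (hΘ.trans hQ)
  obtain ⟨hΘ0, -, hlam⟩ := lam_eq_lam_add_of_mu_eq_zero_of_even hap hn hΘeq hL0 hμ hlt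
  have h := X8.add_sum_totient_le_lam_of_mazurTate_layers hX' hf hΘ hΘ0 hXr S hS
  omega

/-- **Rank-one reading (X8, `♯`, odd `n`)**: with `ord_{s=1} L(E,s) ≠ 0` the accounting runs with
`r = 1` (`T ∣ Θ_n`, §5): **`1 + Σ_{k ∈ S} φ(3^{k+1}) ≤ deg ω_n^+ + λ(L♯)`**. At a tight pair
(`λ♯ = 1`) no layer `k + 1 ≤ n` with `n − (k+1) ≢ 5 (mod 6)` beyond the budget `deg ω_n^+` can vanish.
[cite: Sprung2017, §3, Cor. 3.6 and Thm. 1.12] [cite: Washington1997, §7.1–7.2 and Thm. 7.3] -/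
theorem X8.one_add_sum_totient_le_natDegree_add_lam_sharp_of_analyticRank_ne_zero (hX : ClassX8 W p)
    (hf : IsNewformOf W f) {Lsharp Lflat : IwasawaAlgebra p}
    (hSP : IsSprungPair f p (W.frobeniusTrace p) Lsharp Lflat) (hr : W.analyticRank ≠ 0) {n : ℕ}
    (hn : Odd n) (hL0 : Lsharp ≠ 0) (hμ : mu Lsharp = 0)
    (hlt : lam Lsharp + (cyclotomicOmegaPlus p n).natDegree < p ^ n) {Θ : IwasawaAlgebra p}
    (hΘ : iwasawaToPowerSeries p Θ =
      ((mazurTateElement f p n).map (algebraMap ℚ ℚ_[p]) : PowerSeries ℚ_[p])) (S : Finset ℕ)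
    (hS : ∀ k ∈ S, k + 1 ≤ n ∧ ((n - (k + 1)) % 6 = 5 ∨
      ∃ χ : DirichletCharacter ℂ_[p] (p ^ (k + 1 + cyclotomicExponent p)), χ.IsPrimitive ∧ χ.Even ∧
        (∃ j : ℕ, orderOf χ = p ^ j) ∧ ratTwistedSymbolSum f χ = 0)) :
    1 + ∑ k ∈ S, Nat.totient (p ^ (k + 1)) ≤ (cyclotomicOmegaPlus p n).natDegree + lam Lsharp := by
  have hX' := hX
  obtain ⟨rfl, ⟨hgood, -⟩, -⟩ := hX
  have hp2 : (3 : ℕ) ≠ 2 := by decide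
  have hXr : (PowerSeries.X : IwasawaAlgebra 3) ^ 1 ∣ Θ := by
    rw [pow_one]
    exact X_dvd_mazurTate_of_analyticRank_ne_zero hp2 hf hgood hr hΘ
  exact X8.add_sum_totient_le_natDegree_add_lam_sharp hX' hf hSP hn hL0 hμ hlt hΘ hXr S hS

/-- **Rank-one reading (X8, `♭`, even `n`)**: `1 + Σ_{k ∈ S} φ(3^{k+1}) ≤ deg ω_n^- + λ(L♭)`.
[cite: Sprung2017, §3, Cor. 3.6 and Thm. 1.12] [cite: Washington1997, §7.1–7.2 and Thm. 7.3] -/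
theorem X8.one_add_sum_totient_le_natDegree_add_lam_flat_of_analyticRank_ne_zero (hX : ClassX8 W p)
    (hf : IsNewformOf W f) {Lsharp Lflat : IwasawaAlgebra p}
    (hSP : IsSprungPair f p (W.frobeniusTrace p) Lsharp Lflat) (hr : W.analyticRank ≠ 0) {n : ℕ}
    (hn : Even n) (hL0 : Lflat ≠ 0) (hμ : mu Lflat = 0)
    (hlt : lam Lflat + (cyclotomicOmegaMinus p n).natDegree < p ^ n) {Θ : IwasawaAlgebra p}
    (hΘ : iwasawaToPowerSeries p Θ =
      ((mazurTateElement f p n).map (algebraMap ℚ ℚ_[p]) : PowerSeries ℚ_[p])) (S : Finset ℕ)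
    (hS : ∀ k ∈ S, k + 1 ≤ n ∧ ((n - (k + 1)) % 6 = 5 ∨
      ∃ χ : DirichletCharacter ℂ_[p] (p ^ (k + 1 + cyclotomicExponent p)), χ.IsPrimitive ∧ χ.Even ∧
        (∃ j : ℕ, orderOf χ = p ^ j) ∧ ratTwistedSymbolSum f χ = 0)) :
    1 + ∑ k ∈ S, Nat.totient (p ^ (k + 1)) ≤ (cyclotomicOmegaMinus p n).natDegree + lam Lflat := by
  have hX' := hX
  obtain ⟨rfl, ⟨hgood, -⟩, -⟩ := hX
  have hp2 : (3 : ℕ) ≠ 2 := by decide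
  have hXr : (PowerSeries.X : IwasawaAlgebra 3) ^ 1 ∣ Θ := by
    rw [pow_one]
    exact X_dvd_mazurTate_of_analyticRank_ne_zero hp2 hf hgood hr hΘ
  exact X8.add_sum_totient_le_natDegree_add_lam_flat hX' hf hSP hn hL0 hμ hlt hΘ hXr S hS

end X8

end Summit.BirchSwinnertonDyer.Rank1Residual.Supersingular

end
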